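import Mathlib.MeasureTheory.Function.LpSeminorm.Basic
import Mathlib.Dynamics.Ergodic.MeasurePreserving
import Literature.Analysis.FunctionSpaces.FlatTorus
import Literature.Analysis.FunctionSpaces.TorusCalculus
import Literature.Analysis.FunctionSpaces.TorusTestFunction
import Literature.Analysis.FunctionSpaces.TorusSobolevNorm
import Literature.Analysis.FunctionSpaces.BesovDifference
import Literature.Analysis.FunctionSpaces.TorusFluidGlue
import Literature.Analysis.FluidPDE.WeakSolution
import Literature.Analysis.FluidPDE.LerayHopf
import Literature.Analysis.FluidPDE.DissipationAnomaly
import Literature.Analysis.FluidPDE.TurbWave0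
import HarnessLib

-- provenance: harness21/H21/H21/Statements/Turb/DuchonRobert.lean @ 1958e9d (interim HEAD d8f2665); M5 mechanical rewrite
/-!
# Duchon–Robert defect, the 4/5 law, vanishing-viscosity limits, energy equality
(family: Turb, statements turb.S17, turb.S18, turb.S20, turb.S23; outline
`H21/Outlines/FluidKinetic.md`, item `TurbDuchonRobert`)

Everything lives on the flat unit torus `T^d = UnitAddTorus d` (H21 `FlatTorus`, global
probability `volume`), general `d` where free, `d = Fin 3` for the genuinely three-dimensional
statements; velocity fields are `u : ℝ → UnitAddTorus d → EuclideanSpace ℝ d` (time first).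
No analysis is (re)defined here: all notions are the accepted Prelude ones
(`Torus.HasDuchonRobertDefect`, `Torus.HasLocalEnergyBalance`, `Torus.HasFourFifthsLaw`,
`Torus.HasFourThirdsLaw`, `Torus.TendstoWeakStar`, `Torus.IsDissipationMeasureOf`,
`Torus.IsLerayHopfOn`, `Torus.eGradNormSq`, `Literature.MemLpBesovSup(Vanishing)`, …).

## Contents

* `Turb.velocityIncrement_eq_increment`: the `rfl` bridge between the accepted
  `Turb.velocityIncrement` (Statements/Turb/Wave0) and `Torus.increment` (Prelude
  `DissipationAnomaly`) (outline finding 12).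
* **turb.S17** (Duchon–Robert 2000, Prop. 2 and (10)): `Turb.duchon_robert_defect_exists` — for an
  `L³_{t,x}` distributional Navier–Stokes/Euler solution the defect `D(u)` exists and the local
  energy balance with defect holds (with an explicit weak gradient `G`);
  `Turb.duchon_robert_defect_zero_of_besov` — `D(u) = 0` under the Onsager condition
  `u ∈ L³_t B^α_{3,∞}`, `α > 1/3`.
* **turb.S18** (Kolmogorov 1941c; Duchon–Robert 2000 §4; Eyink 2003 Thm 1):
  `Turb.eyink_local_four_fifths` — the rigorous local 4/5 and 4/3 laws on `T³`; and the K41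
  ensemble form `Turb.K41FourFifthsLaw` (a `def … : Prop`) for a homogeneous
  (`Turb.IsHomogeneous`) isotropic (`Turb.IsIsotropic`) ensemble.
* **turb.S20** (DiPerna–Majda 1987; Buckmaster–Vicol 2019 §8): `Turb.tendstoWeakStar_compact` —
  bounded-energy Leray–Hopf families `νⱼ → 0` have weak-* convergent subsequences with a
  dissipation measure; `Turb.weakLimit_isWeakEuler_of_strong` — under strong `L²_{t,x}`
  convergence the limit is a weak Euler solution.
* **turb.S23** (Lions 1960; Cheskidov–Luo 2021 Thms 1.2–1.4): `Turb.lions_energy_equality`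
  (`L⁴_t L⁴_x`; **refuted as stated and deprecated**, see *Verdict clean-up* below — the corrected
  statement is the proved theorem `lions_energy_equality_Ioc'` of
  `FluidPDE/DuchonRobertLionsEnergyEqualityGeneral`), `Turb.cheskidov_luo_energy_equality`
  (`L³_t B^{1/3}_{3,c₀}`; **refuted as stated and deprecated** likewise),
  `Turb.cheskidov_luo_anomalous` (forced Leray–Hopf solutions with strict energy inequality;
  **unsupported as stated and deprecated** — Cheskidov–Luo 2021, Thm. 1.4 prints the class
  `𝒩(Q_T)` with `f ∈ L^{2-ε}_t H^{-1}`, not `f ∈ L¹_t L²_x` / `Torus.IsLerayHopfOn`).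

## Verdict clean-up (2026-08-16)

* `lions_energy_equality` — **refuted as stated, deprecated.** Its conclusion ranges over
  `t ∈ Icc 0 T`; at `t = 0` it asserts `kineticEnergy (u 0) = kineticEnergy u₀`, but no clause of
  `Torus.IsLerayHopfOn T ν f u₀ u` constrains the slice `u 0` (`energy_ineq_zero` at `t = 0` only
  gives `≤`; weak continuity and the strong attainment of the datum are statements on `Ioc 0 T` and
  along `𝓝[>] 0`). The printed theorems state the equality for the representative that is
  continuous on `[0,T)` with `u(0) = u₀` — Lions 1960, Thm. 1 (p. 17: "après modification
  éventuelle sur un ensemble de mesure nulle, `u` est continue de `[0,T]` dans `K` (fort), avec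
  `u(0) = a`"), Sohr 2001, Ch. V, Thm. 1.4.1 ("after a redefinition on a null set of `[0,T)` …
  (1.4.3) for all `t ∈ [0,T)`"), Beirão da Veiga–Yang 2020, Thm. 1.1 (i) ("for any
  `t₀ ∈ [0,T)`", the system (1.1) carrying `u(·,0) = u₀`) — so their `t = 0` case is the tautology
  `‖u₀‖² = ‖u₀‖²`; the vendored rendering dropped the identification. Kernel-checked refutations
  (kept): `Literature.Analysis.FluidPDE.not_lions_energy_equality` (`T = 0`),
  `Literature.Analysis.FluidPDE.not_lions_energy_equality_of_pos` (every `T > 0`; the steady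
  constant flow `c ≠ 0` with the slice `t = 0` redefined to `0`) and the universal closures
  `not_forall_lions_energy_equality(_pos)`, all in `FluidPDE/DuchonRobertLionsCounterexample`
  (p27575). The corrected statement — conclusion for `t ∈ Ioc 0 T`, datum `u₀ ∈ L²`, jointly
  measurable force, no sign condition on `ν` — is **proved** in tree:
  `Literature.Analysis.FluidPDE.lions_energy_equality_Ioc'`
  (`FluidPDE/DuchonRobertLionsEnergyEqualityGeneral`, every finite `d`; Shinbrot's dimension-free
  mollification) and `Literature.Analysis.FluidPDE.lions_energy_equality_Ioc`
  (`FluidPDE/DuchonRobertLionsEnergyEquality`, `2 ≤ d ≤ 4`). It is not re-declared here (both files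
  import this one; a restatement would duplicate them). The `def` is kept verbatim only because
  its refutations name it, and carries `@[deprecated]`.
* `cheskidov_luo_energy_equality` — **refuted as stated, deprecated** (same defect, same witness:
  `Literature.Analysis.FluidPDE.not_cheskidov_luo_energy_equality(_of_pos)` and
  `not_forall_cheskidov_luo_energy_equality(_pos)` in `FluidPDE/DuchonRobertCheskidovLuoCounterexample`;
  CCFS 2008, Thm. 3.3 works in `C_w([0,T]; L²)`). Its corrected form (conclusion on `Ioc 0 T`) is
  not vendored here because no source read prints the *forced* Leray–Hopf statement in
  `L³B^{1/3}_{3,c₀}` (CCFS 2008: Euler, no force; Cheskidov–Luo 2020: unforced NSE, weak-in-time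
  classes) — a faithful named fact must first fix its source and force class.
* `cheskidov_luo_anomalous` — **unsupported as stated, deprecated** (found when resolving its
  migration citation tag; review of p87875): Cheskidov–Luo 2021, Thm. 1.4 prints an existence
  statement in the class `𝒩(Q_T)` (smooth on `T^d × (0,T)`, finite energy input; Def. 2.1) with
  force `f ∈ L^{2-ε}_t H^{-1}`, energy equality on `[0,T)` and an energy jump at `t = T`, and
  notes (§2.2) that `𝒩(Q_T)` pairs are in general not Leray–Hopf on `[0,T]`; the record asserts
  `f ∈ L¹(0,T; L²)` and `Torus.IsLerayHopfOn`, which are not printed. Not refuted; no faithful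
  restatement in tree yet (it needs `H^{-1}`-valued force classes this file lacks) — left to a
  planner / literature seat, with the printed form quoted in the docstring.
* The two other pending-citation tags of the migration were resolved against the sources
  (`duchon_robert_defect_exists`: Duchon–Robert 2000, Prop. 2/(10), cite-only `acq-00125`, restated
  in Novack 2024 §1; `tendstoWeakStar_compact`: DiPerna–Majda 1987, §1 Theorem/§5; statements
  unchanged).

## Design choices

* **Dissipation is always spectral or weak, never pointwise** (outline finding 5): the energy
  (in)equalities use `Torus.eGradNormSq` (spectral `‖∇u‖₂²` of the complexified field), exactly
  as in the fields `energy_ineq_zero`/`energy_ineq_ae` of `Torus.IsLerayHopfOn`; the local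
  balance and dissipation measures use explicit weak gradients (`Torus.HasWeakGradient`).
* turb.S17 is stated for the accepted pressure-explicit `Torus.IsDistributionalNSSolutionOn T ν 0
  u p` (DR test the balance against arbitrary scalar test functions, so the pressure must be a
  genuine function); the DR hypotheses `u ∈ L³_{t,x}`, `p ∈ L^{3/2}_{t,x}` and, for `ν > 0`,
  `u ∈ L²_t H¹_x` (spectral `Torus.MemL2Sobolev 0 T 1` of the complexified field, the Leray–Hopf
  class) are explicit hypotheses.
* The Besov class is the G03 `MemLpBesovSup 3 α 3 u volume (Ioo 0 T)` directly (measure argument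
  `volume` on `T^d`; no dependency on `Statements/Turb/Onsager`).
* **K41 ensemble form.** An "ensemble" is a measure `μ` on velocity fields
  `UnitAddTorus d → EuclideanSpace ℝ d` with the product σ-algebra (Mathlib `MeasurableSpace.pi`);
  homogeneity is invariance under torus translations (`MeasureTheory.MeasurePreserving`),
  isotropy is invariance in law under the finite symmetry group of the cube lattice `ℤ^d`
  (signed coordinate permutations) — the periodic box breaks full `O(d)` isotropy, and we say so.
  Stationarity refers to a time-dependent ensemble and is not a property of the single-time
  marginal `μ`; the mean dissipation rate `ε` enters K41's law as the parameter of the idealised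
  infinite-Reynolds-number ensemble and is therefore an explicit argument (K41 takes `ν → 0`
  before `ℓ → 0`; at fixed `ν > 0` the `ℓ → 0` limit of `ℓ⁻¹ S₃(ℓ)` is `0`). Definition only.
* turb.S20: measure-valued / dissipative Euler solutions (DiPerna–Majda 1987 §4; Lions 1996) are
  **not** formalised in v0 (outline §4.6); only weak-* limits and dissipation measures are.
* Strong convergence hypotheses are written measure-theoretically as
  `Tendsto (m ↦ ∫⁻∫⁻ ‖u_m − u‖ₑ^q) atTop (𝓝 0)`, as in the accepted
  `Torus.IsDissipationMeasureOf.hasDuchonRobertDefect`.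

## Mathlib search

Mathlib (this pin) has `MeasureTheory.MeasurePreserving`, `Measure.map`, `MeasurableSpace.pi`,
`Equiv.Perm`, `ℤˣ`, `nhdsWithin`/`𝓝[>]`, `intervalIntegral`, `MeasureTheory.eLpNorm`/`MemLp`;
it has no structure functions, Duchon–Robert defect, dissipation measures, Leray–Hopf solutions,
homogeneity/isotropy predicates for random fields or Kolmogorov laws (searched `Isotropic`,
`Homogeneous` (measure sense), `structureFunction`, `LerayHopf`, `Onsager`, `Kolmogorov` — only
unrelated hits, e.g. `Kolmogorov` extension/0-1 law in `Mathlib/Probability`).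

## References

* J. Duchon, R. Robert, *Inertial energy dissipation for weak solutions of incompressible Euler
  and Navier–Stokes equations*, Nonlinearity 13 (2000), Prop. 2, (9)–(12), §4.
* G. L. Eyink, *Local 4/5-law and energy dissipation anomaly in turbulence*, Nonlinearity 16
  (2003), Thm. 1, (1.5)–(1.7).
* A. N. Kolmogorov, *Dissipation of energy in the locally isotropic turbulence*, Dokl. Akad. Nauk
  SSSR 32 (1941) ("1941c"); U. Frisch, *Turbulence* (1995), §6.2.
* R. J. DiPerna, A. J. Majda, *Oscillations and concentrations in weak solutions of the
  incompressible fluid equations*, Comm. Math. Phys. 108 (1987), §1.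
* T. Buckmaster, V. Vicol, *Convex integration and phenomenologies in turbulence*, EMS Surv.
  Math. Sci. 6 (2019), §8.
* J.-L. Lions, *Sur la régularité et l'unicité des solutions turbulentes des équations de Navier
  Stokes*, Rend. Sem. Mat. Univ. Padova 30 (1960), 16–23, Thm. 1. [Lions1960]
* M. Shinbrot, *The energy equation for the Navier–Stokes system*, SIAM J. Math. Anal. 5 (1974),
  948–954. [Shinbrot1974]
* H. Sohr, *The Navier–Stokes Equations*, Birkhäuser 2001, Ch. V, Thm. 1.4.1. [Sohr2001]
* H. Beirão da Veiga, J. Yang, *On the Shinbrot's criteria for energy equality to Newtonian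
  fluids*, Nonlinear Anal. 196 (2020) = arXiv:1912.10249, Thm. 1.1. [VeigaYang2019]
* A. Cheskidov, P. Constantin, S. Friedlander, R. Shvydkoy, *Energy conservation and Onsager's
  conjecture for the Euler equations*, Nonlinearity 21 (2008) = arXiv:0704.0759, Thm. 1.1 /
  Thm. 3.3. [CheskidovConstantinFriedlanderShvydkoy2008]
* R. J. DiPerna, A. J. Majda — see above; §5, (5.2)–(5.3), Prop. 5.1. [DiPernaMajda1987]
* A. Cheskidov, X. Luo, *Anomalous dissipation, anomalous work, and energy balance for the
  Navier–Stokes equations*, SIAM J. Math. Anal. 53 (2021) = arXiv:1910.04204, Thms. 1.2–1.4,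
  Def. 2.1. [CheskidovLuo2021]
* A. Cheskidov, X. Luo, *Energy equality for the Navier–Stokes equations in weak-in-time Onsager
  spaces*, Nonlinearity 33 (2020) = arXiv:1802.05785, §1, Thms. 1.1, 1.3. [CheskidovLuo2020]
* M. Novack, *Scaling laws and exact results in turbulence*, Nonlinearity 37 (2024) =
  arXiv:2310.01375, §1 (restates the Duchon–Robert distribution and balance). [Novack2024]
-/

noncomputable section

open MeasureTheory TopologicalSpace Set Function Filter Topology Metric
open scoped InnerProductSpace RealInnerProductSpace ENNReal NNReal

namespace Literature.Analysis.FluidPDE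

variable {d : Type*} [Fintype d]

/-! ## The increment bridge -/

omit [Fintype d] in
/-- **Bridge** (outline finding 12): the accepted Wave0 increment `Turb.velocityIncrement u ⇑ξ x =
u (x + toTorus ⇑ξ) - u x` and the Prelude increment `Torus.increment u ξ x = u (x + Torus.proj ξ)
- u x` agree definitionally (`Torus.proj ξ = Turb.toTorus ⇑ξ` by `rfl`) (Duchon–Robert 2000,
before (9); Frisch 1995, §6.1). [cite: DuchonRobert2000, before (9] -/
theorem velocityIncrement_eq_increment {E : Type*} [AddCommGroup E] (u : UnitAddTorus d → E)
    (ξ : EuclideanSpace ℝ d) (x : UnitAddTorus d) :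
    velocityIncrement u (⇑ξ) x = Torus.increment u ξ x :=
  rfl

/-! ## turb.S17: the Duchon–Robert defect -/

section DuchonRobert

variable [DecidableEq d] {T ν : ℝ} {u : ℝ → UnitAddTorus d → EuclideanSpace ℝ d}
  {p : ℝ → UnitAddTorus d → ℝ}

/-- **turb.S17** (Duchon–Robert, Nonlinearity 13 (2000), Prop. 2 and (10)). Let `(u, p)` be a
distributional solution of Navier–Stokes (`ν > 0`) or Euler (`ν = 0`) on `T^d × (0, T)` without
force, with `u ∈ L³((0,T) × T^d)`, `p ∈ L^{3/2}((0,T) × T^d)` and, in the viscous case,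
`u ∈ L²(0,T; H¹)`. Then the defect
`D(u) = lim_{ε → 0} ¼ ∫ ∇φ^ε(ξ) · δu |δu|² dξ` exists in `𝒟'((0,T) × T^d)`, is independent of the
mollifier `φ` (`Torus.HasDuchonRobertDefect`), and the local energy balance
`∂ₜ(½|u|²) + div(u(½|u|² + p)) − νΔ(½|u|²) + ν|∇u|² + D(u) = 0` holds
(`Torus.HasLocalEnergyBalance`, with an explicit integrable weak spatial gradient `G` of `u`,
needed only when `ν ≠ 0`; the dissipation `ν|∇u|²` is `ν · weakGradNormSq G`, never a pointwise
gradient). Source status: the printed paper is cite-only on this hub (acquisition `acq-00125`);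
the defect `D(u)` and the balance (10) are restated, with the same normalisation
`D[u] = lim_{ℓ→0} ¼ ∫ ∇φ_ℓ(y) · δu |δu|² dy` under the sole assumption `u ∈ L³_{t,x}`, in Novack,
Nonlinearity 37 (2024) = arXiv:2310.01375, §1.
[cite: DuchonRobert2000, Prop. 2 and (10); restated in Novack2024 §1] -/
def duchon_robert_defect_exists : Prop :=
  ∀ (hT : 0 ≤ T) (hν : 0 ≤ ν) (hsol : Torus.IsDistributionalNSSolutionOn T ν 0 u p) (hu3 : Torus.MemLqLp 3 3 u (Ioo 0 T)) (hp : Torus.MemLqLp (3 / 2) (3 / 2) p (Ioo 0 T)) (hH1 : ν ≠ 0 → FunctionSpaces.Torus.MemL2Sobolev 0 T 1 (fun t => FunctionSpaces.EuclideanSpace.complexify ∘ u t)),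
    ∃ D : Torus.STFunctional d, Torus.HasDuchonRobertDefect T u D ∧
      ∃ G : ℝ → UnitAddTorus d → EuclideanSpace ℝ d →L[ℝ] EuclideanSpace ℝ d,
        (ν ≠ 0 → ∀ᵐ t ∂(volume.restrict (Ioo 0 T)),
          Torus.HasWeakGradient (u t) (G t) ∧ Integrable (G t) volume) ∧
        Torus.HasLocalEnergyBalance T ν u p G D

omit [DecidableEq d] in
/-- **turb.S17** (Duchon–Robert, Nonlinearity 13 (2000), Prop. 2 ff. and Thm. of §4: "`D(u) = 0`
under the Onsager condition"; Constantin–E–Titi 1994). If `u ∈ L³(0,T; B^α_{3,∞}(T^d))` with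
`α > 1/3` (G03 `MemLpBesovSup 3 α 3 u volume (Ioo 0 T)`) has Duchon–Robert defect `D`, then
`D = 0` on all test functions supported in `(0, T)`: indeed
`|∫∫ D_ε(u) ψ| ≲ ε^{3α − 1} ‖u‖³_{L³B^α_{3,∞}} ‖ψ‖_∞ → 0`. Joint measurability of `u` on
`(0,T) × T^d` is assumed (it is part of every solution notion). [cite: Titi1994] -/
def duchon_robert_defect_zero_of_besov : Prop :=
  ∀ {D : Torus.STFunctional d} (hD : Torus.HasDuchonRobertDefect T u D) (hmeas : AEStronglyMeasurable (FunctionSpaces.Torus.stLift u) (volume.restrict (Ioo 0 T ×ˢ univ))) {α : ℝ} (hu : FunctionSpaces.MemLpBesovSup 3 α 3 u volume (Ioo 0 T)) (hα : 1 / 3 < α) {ψ : ℝ → UnitAddTorus d → ℝ} (hψ : FunctionSpaces.Torus.IsSpaceTimeTestIoo T ψ),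
    D ψ = 0

end DuchonRobert

/-! ## turb.S18: the 4/5 law -/

section FourFifths

-- the three-dimensional torus and velocity space
local notation "𝕋³" => UnitAddTorus (Fin 3)
local notation "E³" => EuclideanSpace ℝ (Fin 3)

/-- **turb.S18**, rigorous local form (Eyink, Nonlinearity 16 (2003), Thm. 1, (1.6)–(1.7);
Duchon–Robert 2000, §4, (11)–(12)). Let `u ∈ L³((0,T) × T³)` be a weak Euler solution with
Duchon–Robert defect `D(u)`. Then, in the sense of distributions on `(0,T) × T³`,
`lim_{ℓ → 0} ℓ⁻¹ ⟨(δ_L u(ℓ))³⟩_{ang} = −(4/5) D(u)` (**4/5 law**, `Torus.HasFourFifthsLaw`, whose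
constant `12/(d(d+2))` is `4/5` for `d = 3`, `Torus.fourFifths_const_fin_three`) and
`lim_{ℓ → 0} ℓ⁻¹ ⟨δ_L u |δu|²(ℓ)⟩_{ang} = −(4/3) D(u)` (**4/3 law**, `Torus.HasFourThirdsLaw`). [cite: DuchonRobert2000, §4  (11] -/
def eyink_local_four_fifths : Prop :=
  ∀ {T : ℝ} {u : ℝ → 𝕋³ → E³} {D : Torus.STFunctional (Fin 3)} (hD : Torus.HasDuchonRobertDefect T u D) (hE : FunctionSpaces.Torus.IsWeakEulerSolutionOn T u) (hu3 : Torus.MemLqLp 3 3 u (Ioo 0 T)),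
    Torus.HasFourFifthsLaw T u D ∧ Torus.HasFourThirdsLaw T u D

/-! ### K41 ensemble form -/

/-- **Translation of a field** on `T^d` by `a`: `(τ_a u)(x) = u(x + a)` (Frisch 1995, §6.1:
homogeneity = invariance of the ensemble under translations). [cite: Frisch1995, §6.1: homogeneity = invariance of the en] -/
def translateField {E : Type*} (a : UnitAddTorus d) (u : UnitAddTorus d → E) :
    UnitAddTorus d → E :=
  fun x => u (x + a)

/-- A **symmetry of the cube lattice** `ℤ^d` (an element of the hyperoctahedral group: a signed
coordinate permutation `e_{σ j} ↦ s_j e_j`) acting on the torus `T^d = ℝ^d/ℤ^d`: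
`(B x)_j = s_j · x_{σ j}`. These are exactly the linear isometries of `ℝ^d` preserving `ℤ^d`,
hence the rotational symmetries available on the periodic box (Frisch 1995, §6.1; the periodic
box breaks full `O(d)` isotropy). [cite: Frisch1995, §6.1] -/
def cubeSymm (σ : Equiv.Perm d) (s : d → ℤˣ) (x : UnitAddTorus d) : UnitAddTorus d :=
  fun j => ((s j : ℤ) : ℤ) • x (σ j)

/-- The same cube-lattice symmetry acting on velocity vectors: `(B v)_j = s_j · v_{σ j}`
(an orthogonal map of `ℝ^d`; Frisch 1995, §6.1). [cite: Frisch1995, §6.1] -/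
def cubeSymmVec (σ : Equiv.Perm d) (s : d → ℤˣ) (v : EuclideanSpace ℝ d) : EuclideanSpace ℝ d :=
  WithLp.toLp 2 fun j => ((s j : ℤ) : ℝ) * v (σ j)

/-- **Homogeneity** of an ensemble (a measure `μ` on velocity fields `T^d → ℝ^d`, product
σ-algebra): `μ` is invariant under all torus translations `u ↦ u(· + a)`
(`MeasureTheory.MeasurePreserving`) (Kolmogorov 1941; Frisch 1995, §6.1, hypothesis H1). [cite: Kolmogorov1941] -/
def IsHomogeneous (μ : Measure (UnitAddTorus d → EuclideanSpace ℝ d)) : Prop :=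
  ∀ a : UnitAddTorus d, MeasurePreserving (translateField a) μ μ

/-- **Isotropy** of an ensemble on the periodic box: for every symmetry `B` of the cube lattice
(signed coordinate permutation), the fields `x ↦ B u(x)` and `x ↦ u(B x)` have the same law
under `μ` — equivalently `μ` is invariant under `u ↦ B ∘ u ∘ B⁻¹` (Kolmogorov 1941; Frisch 1995,
§6.1, hypothesis H2). **Caveat (documented design choice):** on `T^d` only the finite
hyperoctahedral group acts, so this is *cubic* isotropy, the most that the periodic setting
admits; K41's hypothesis is full rotational isotropy of the local structure of the flow. [cite: Kolmogorov1941] -/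
def IsIsotropic (μ : Measure (UnitAddTorus d → EuclideanSpace ℝ d)) : Prop :=
  ∀ (σ : Equiv.Perm d) (s : d → ℤˣ),
    μ.map (fun u => cubeSymmVec σ s ∘ u) = μ.map (fun u => u ∘ cubeSymm σ s)

/-- **turb.S18**, K41 ensemble form — **Kolmogorov's four-fifths law** (Kolmogorov 1941c,
eq. (7); Frisch 1995, §6.2, (6.5): `⟨(δu_∥(ℓ))³⟩ = −(4/5) ε ℓ` for small `ℓ` in the inertial
range). For a homogeneous, (cubically) isotropic ensemble `μ` of velocity fields on `T^d` with
mean energy dissipation rate `ε`, the ensemble-averaged third-order longitudinal structure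
function `⟨S₃^∥(e, ℓ)⟩_μ = ∫ (∫_{T^d} (δu(x; ℓe) · e)³ dx) dμ(u)` (Wave0
`Turb.longitudinalStructureFunction 3`) satisfies
`⟨S₃^∥(e, ℓ)⟩_μ = −C_d ε ℓ + o(ℓ)` as `ℓ → 0⁺` for every unit vector `e`, with
`C_d = 12/(d(d+2))` (`= 4/5` for `d = 3`, the constant of `Torus.HasFourFifthsLaw`).
This is a `def … : Prop` (a physical law, not a theorem): `μ` is thought of as the single-time
marginal of a stationary ensemble in the infinite-Reynolds-number limit, and `ε` — its anomalous
mean dissipation rate — is an explicit parameter (K41 lets `ν → 0` before `ℓ → 0`; for fixed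
`ν > 0` the left-hand side tends to `0`). The rigorous deterministic counterpart is
`eyink_local_four_fifths`. [cite: Kolmogorov1941, c  eq. (7] -/
def K41FourFifthsLaw (μ : Measure (UnitAddTorus d → EuclideanSpace ℝ d)) (ε : ℝ) : Prop :=
  IsHomogeneous μ ∧ IsIsotropic μ ∧
    ∀ e : EuclideanSpace ℝ d, ‖e‖ = 1 →
      Tendsto (fun ℓ : ℝ => ℓ⁻¹ * ∫ u, longitudinalStructureFunction 3 u e ℓ ∂μ) (𝓝[>] 0)
        (𝓝 (-(12 / ((Fintype.card d : ℝ) * (Fintype.card d + 2))) * ε))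

omit [Fintype d] in
/-- Translation by `0` is the identity. [folklore] -/
@[simp]
theorem translateField_zero {E : Type*} (u : UnitAddTorus d → E) : translateField 0 u = u := by
  funext x
  simp [translateField]

omit [Fintype d] in
/-- Translations compose additively:
`translateField a (translateField b u) = translateField (a + b) u`. [folklore] -/
theorem translateField_translateField {E : Type*} (a b : UnitAddTorus d)
    (u : UnitAddTorus d → E) :
    translateField a (translateField b u) = translateField (a + b) u := by
  funext x
  simp [translateField, add_assoc]

omit [Fintype d] in
/-- The trivial cube symmetry (`σ = 1`, all signs `+1`) acts as the identity on the torus. [folklore] -/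
@[simp]
theorem cubeSymm_one (x : UnitAddTorus d) : cubeSymm (1 : Equiv.Perm d) (fun _ => 1) x = x := by
  funext j
  simp [cubeSymm]

omit [Fintype d] in
/-- The trivial cube symmetry acts as the identity on vectors. [folklore] -/
@[simp]
theorem cubeSymmVec_one (v : EuclideanSpace ℝ d) :
    cubeSymmVec (1 : Equiv.Perm d) (fun _ => 1) v = v := by
  ext j
  simp [cubeSymmVec]

/-- Cube symmetries are isometries of `ℝ^d`: `‖B v‖ = ‖v‖` (a signed permutation of an
orthonormal basis). [folklore] -/
theorem norm_cubeSymmVec (σ : Equiv.Perm d) (s : d → ℤˣ) (v : EuclideanSpace ℝ d) :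
    ‖cubeSymmVec σ s v‖ = ‖v‖ := by
  rw [EuclideanSpace.norm_eq, EuclideanSpace.norm_eq, ← Equiv.sum_comp σ (fun i => ‖v i‖ ^ 2)]
  congr 1
  refine Finset.sum_congr rfl fun j _ => ?_
  rcases Int.units_eq_one_or (s j) with hj | hj <;> simp [cubeSymmVec, hj]

omit [Fintype d] in
/-- The Dirac ensemble at the zero field is homogeneous (a sanity check on the definition). [folklore] -/
theorem isHomogeneous_dirac_zero :
    IsHomogeneous (Measure.dirac (0 : UnitAddTorus d → EuclideanSpace ℝ d)) := by
  intro a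
  have hmeas : Measurable (translateField (E := EuclideanSpace ℝ d) a) :=
    measurable_pi_lambda _ fun x => measurable_pi_apply _
  refine ⟨hmeas, ?_⟩
  rw [Measure.map_dirac' hmeas]
  rfl

end FourFifths

/-! ## turb.S20: vanishing-viscosity limit objects -/

section VanishingViscosity

variable [DecidableEq d] {T : ℝ} {νseq : ℕ → ℝ} {useq : ℕ → ℝ → UnitAddTorus d → EuclideanSpace ℝ d}
  {u₀seq : ℕ → UnitAddTorus d → EuclideanSpace ℝ d} {u : ℝ → UnitAddTorus d → EuclideanSpace ℝ d}

/-- **turb.S20** (vanishing-viscosity limit objects; DiPerna–Majda, Comm. Math. Phys. 108 (1987),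
§1; Buckmaster–Vicol, EMS Surv. 2019, §8). Let `u_m` be unforced Leray–Hopf solutions on
`T^d × [0, T)` with viscosities `ν_m > 0`, `ν_m → 0`, and data of uniformly bounded kinetic
energy. Then along a subsequence `u_{φ(m)} ⇀* u` weak-* in `L^∞(0,T; L²)`
(`Torus.TendstoWeakStar`, from the energy inequality and Banach–Alaoglu) and the dissipation
measures `ν_{φ(m)} |∇u_{φ(m)}|² dx dt` converge weakly to a finite measure `D` on `[0,T] × T^d`
(`Torus.IsDissipationMeasureOf`, built from weak gradients). **Not formalised in v0:**
DiPerna–Majda's measure-valued solutions and Lions' dissipative solutions of Euler (outline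
§4.6); only the weak-* limit `u` and the dissipation measure `D` are. In the source the
viscous family is any family of Leray–Hopf solutions with a fixed smooth datum `v₀ ∈ L²(ℝ³)`
(§1, Theorem, proved in §5 from the energy inequality (5.2), the identity (5.3) and Prop. 5.1);
the weak-* subsequence is the Banach–Alaoglu step of that proof and the dissipation measure is
the weak limit of the bounded measures `ν_m|∇u_m|² dx dt` (mass `≤ ½‖u₀‖₂²` by (5.2)).
[cite: DiPernaMajda1987, §1 Theorem and §5, (5.2)–(5.3) with Prop. 5.1 (weak-* / dissipation-measure part only)] -/
def tendstoWeakStar_compact : Prop :=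
  ∀ (hν : ∀ m, 0 < νseq m) (hν0 : Tendsto νseq atTop (𝓝 0)) (hLH : ∀ m, Torus.IsLerayHopfOn T (νseq m) 0 (u₀seq m) (useq m)) (hE : ∃ C : ℝ, ∀ m, FunctionSpaces.Torus.kineticEnergy (u₀seq m) ≤ C),
    ∃ φ : ℕ → ℕ, StrictMono φ ∧
      ∃ (u : ℝ → UnitAddTorus d → EuclideanSpace ℝ d) (D : Measure (ℝ × UnitAddTorus d)),
        Torus.TendstoWeakStar (useq ∘ φ) u T ∧
          Torus.IsDissipationMeasureOf (νseq ∘ φ) (useq ∘ φ) T D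

/-- **turb.S20** (strong limits are weak Euler solutions; DiPerna–Majda 1987, §1, Prop. 1.1 ff.;
Buckmaster–Vicol 2019, §8). If unforced Leray–Hopf solutions `u_m` with `ν_m → 0` converge to
`u` weak-* in `L^∞_t L²_x` and moreover **strongly** in `L²((0,T) × T^d)`, then `u` (assumed
jointly a.e. strongly measurable, as every representative of the limit class is) is a weak
solution of the incompressible Euler equations on `T^d × (0,T)` (`Torus.IsWeakEulerSolutionOn`):
the nonlinear term `∫∫ ⟪u_m, (u_m · ∇)ψ⟫` passes to the limit under strong `L²` convergence and
the viscous term `ν_m ∫∫ ⟪u_m, Δψ⟫` vanishes. [cite: DiPernaMajda1987, §1  Prop. 1.1 ff] -/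
def weakLimit_isWeakEuler_of_strong : Prop :=
  ∀ (hν0 : Tendsto νseq atTop (𝓝 0)) (hLH : ∀ m, Torus.IsLerayHopfOn T (νseq m) 0 (u₀seq m) (useq m)) (hw : Torus.TendstoWeakStar useq u T) (hmeas : AEStronglyMeasurable (FunctionSpaces.Torus.stLift u) (volume.restrict (Ioo 0 T ×ˢ univ))) (hstrong : Tendsto (fun m => ∫⁻ t in Ioo 0 T, ∫⁻ x, ‖useq m t x - u t x‖ₑ ^ 2) atTop (𝓝 0)),
    FunctionSpaces.Torus.IsWeakEulerSolutionOn T u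

end VanishingViscosity

/-! ## turb.S23: energy equality and anomalous dissipation/work -/

section EnergyEquality

variable [DecidableEq d] {T ν : ℝ} {f u : ℝ → UnitAddTorus d → EuclideanSpace ℝ d}
  {u₀ : UnitAddTorus d → EuclideanSpace ℝ d}

/-- **Refuted as stated — deprecated (verdict clean-up 2026-08-16); kept, statement byte-for-byte,
only because its refutations name it.** The record was meant to vendor **turb.S23, Lions' energy
equality** (J.-L. Lions, Rend. Sem. Mat. Univ. Padova 30 (1960), Thm. 1; Shinbrot, SIAM J. Math.
Anal. 5 (1974), case `p = r = 4`; Sohr 2001, Ch. V, Thm. 1.4.1, (1.4.3); Beirão da Veiga–Yang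
2020, Thm. 1.1 (i)): a Leray–Hopf solution on `T^d × [0,T)` with `u ∈ L⁴((0,T) × T^d)` and force
`f ∈ L¹(0,T; L²)` satisfies `½‖u(t)‖² + ν ∫₀ᵗ ‖∇u‖₂² = ½‖u₀‖² + ∫₀ᵗ∫ ⟪f, u⟫` — the field
`energy_ineq_zero` of `Torus.IsLerayHopfOn` with equality, the dissipation being the spectral
`Torus.eGradNormSq`. **What is wrong:** the conclusion is quantified over `t ∈ Icc 0 T`, and at
`t = 0` (both integrals over `Ioo 0 0 = ∅` / `0..0`) it asserts
`kineticEnergy (u 0) = kineticEnergy u₀`; but no clause of `Torus.IsLerayHopfOn T ν f u₀ u`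
constrains the slice `u 0` (the weak formulation and the classes are integrals / a.e. statements
over `Ioo 0 T`; `weak_continuous`, `strong_initial` live on `Ioc 0 T` and along `𝓝[>] 0`;
`memLp` only asks `u 0 ∈ L²`; `energy_ineq_zero` at `t = 0` only gives
`kineticEnergy (u 0) ≤ kineticEnergy u₀`). In the printed theorems the solution is the
representative continuous on `[0,T)` with `u(0) = u₀` (Lions 1960, Thm. 1: "après modification
éventuelle sur un ensemble de mesure nulle … avec `u(0) = a`"; Sohr 2001, Ch. V, Thm. 1.4.1: "after a
redefinition on a null set of `[0,T)`"), so that their case `t = 0` is the tautology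
`‖u₀‖² = ‖u₀‖²`; the vendored rendering dropped this identification, and redefining `u 0 := 0`
keeps every hypothesis while breaking the conclusion as soon as `u₀ ≠ 0`.
**Refutation (kernel-checked, kept):** `Literature.Analysis.FluidPDE.not_lions_energy_equality`
(`T = 0`) and `Literature.Analysis.FluidPDE.not_lions_energy_equality_of_pos` (every `T > 0`,
`ν ≥ 0`; witness the steady constant flow `c ≠ 0` with the slice `t = 0` redefined to `0`, zero
force), with the universal closures `not_forall_lions_energy_equality(_pos)` (`T³`, `ν = 1`), all
in `Literature/Analysis/FluidPDE/DuchonRobertLionsCounterexample.lean` (p27575).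
**Corrected statement — use instead (proved in tree):** the theorem
`Literature.Analysis.FluidPDE.lions_energy_equality_Ioc'`
(`FluidPDE/DuchonRobertLionsEnergyEqualityGeneral.lean`, every finite `d`): the same hypotheses
plus `u₀ ∈ L²` (`MemLp u₀ 2 volume`) and joint measurability of `f` on `(0,T) × T^d`, no sign
condition on `ν`, and the conclusion for every `t ∈ Ioc 0 T`; its `2 ≤ d ≤ 4` predecessor is
`Literature.Analysis.FluidPDE.lions_energy_equality_Ioc`
(`FluidPDE/DuchonRobertLionsEnergyEquality.lean`). Neither is re-declared here (both files import
this one); no `lions_energy_equality_holds` can exist.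
[cite: Shinbrot1974, Thm. (p = r = 4: Lions1960 Thm. 1); Sohr2001 Ch. V Thm. 1.4.1 (1.4.3)] -/
@[deprecated "refuted as stated (its t = 0 case speaks about the unconstrained slice u 0): see \
  Literature.Analysis.FluidPDE.not_lions_energy_equality and not_lions_energy_equality_of_pos \
  (DuchonRobertLionsCounterexample.lean); corrected statement, proved: the theorem \
  Literature.Analysis.FluidPDE.lions_energy_equality_Ioc' (DuchonRobertLionsEnergyEqualityGeneral.lean: \
  t ∈ Ioc 0 T, datum u₀ ∈ L², jointly measurable force), or lions_energy_equality_Ioc for 2 ≤ d ≤ 4"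
  (since := "2026-08-16")]
def lions_energy_equality : Prop :=
  ∀ (hLH : Torus.IsLerayHopfOn T ν f u₀ u) (hν : 0 ≤ ν) (hu4 : Torus.MemLqLp 4 4 u (Ioo 0 T)) (hf : Torus.MemLqLp 1 2 f (Ioo 0 T)),
    ∀ t ∈ Icc 0 T,
      FunctionSpaces.Torus.kineticEnergy (u t) + ν * (∫⁻ τ in Ioo 0 t, FunctionSpaces.Torus.eGradNormSq (u τ)).toReal =
        FunctionSpaces.Torus.kineticEnergy u₀ + ∫ τ in 0..t, ∫ x, ⟪f τ x, u τ x⟫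

/-- **Refuted as stated — deprecated (verdict clean-up 2026-08-16); kept, statement byte-for-byte,
only because its refutations name it.** The record was meant to vendor **turb.S23, the energy
equality in the Onsager-critical vanishing Besov class**: a Leray–Hopf solution on `T^d × [0,T)`
with `u ∈ L³(0,T; B^{1/3}_{3,c₀}(T^d))` (G03 `MemLpBesovSupVanishing 3 (1/3) 3 u volume (Ioo 0 T)`)
and force `f ∈ L¹(0,T; L²)` satisfies the energy equality (spectral dissipation
`Torus.eGradNormSq`), after Cheskidov–Constantin–Friedlander–Shvydkoy, Nonlinearity 21 (2008) =
arXiv:0704.0759, Thm. 3.3 (= Thm. 1.1 of the introduction): "every weak solution to the Euler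
equation that belongs to the class `L³([0,T]; B^{1/3}_{3,c(ℕ)}) ∩ C_w([0,T]; L²)` conserves
energy", whose commutator estimate is routinely transferred to Leray–Hopf solutions of
Navier–Stokes (Cheskidov–Luo, Nonlinearity 33 (2020) = arXiv:1802.05785, §1: "the result of
[CCFS] also implies energy equality" in the endpoint class; Cheskidov–Luo, SIAM J. Math. Anal. 53
(2021), §1.3, sharpness discussion after Thm. 1.4). **What is wrong:** exactly the defect of its
sibling `lions_energy_equality` — the conclusion ranges over `t ∈ Icc 0 T` and at `t = 0`
asserts `kineticEnergy (u 0) = kineticEnergy u₀`, while no clause of `Torus.IsLerayHopfOn` (nor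
the Besov hypothesis, an integral condition over `Ioo 0 T`) constrains the slice `u 0`; the
printed class `C_w([0,T]; L²)` with `u(0) = u₀` is what makes `t = 0` a tautology there.
**Refutation (kernel-checked, kept):**
`Literature.Analysis.FluidPDE.not_cheskidov_luo_energy_equality` (`T = 0`),
`Literature.Analysis.FluidPDE.not_cheskidov_luo_energy_equality_of_pos` (every `T > 0`, `ν ≥ 0`;
the steady constant flow `c ≠ 0` with the slice `t = 0` redefined to `0` lies in every
`L^q(0,T; B^s_{p,c₀})`), and the universal closures `not_forall_cheskidov_luo_energy_equality(_pos)`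
(`T³`, `ν = 1`), all in `Literature/Analysis/FluidPDE/DuchonRobertCheskidovLuoCounterexample.lean`.
**Corrected statement:** the same implication with the conclusion for `t ∈ Ioc 0 T` (datum
`u₀ ∈ L²`, jointly measurable force), as for the Lions sibling whose corrected form is the proved
theorem `Literature.Analysis.FluidPDE.lions_energy_equality_Ioc'`. It is deliberately **not
vendored here**: none of the sources above prints a *forced* Leray–Hopf statement in the class
`L³B^{1/3}_{3,c₀}` (CCFS 2008 is Euler without force; Cheskidov–Luo 2020, Thms. 1.1/1.3 are the
unforced 3D NSE in weak-in-time Onsager classes), so a faithful named fact has to fix its source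
and force class first; no `cheskidov_luo_energy_equality_holds` can exist.
[cite: CheskidovConstantinFriedlanderShvydkoy2008, Thm. 3.3 (Euler, C_w([0,T];L²)); NSE transfer: CheskidovLuo2020 §1] -/
@[deprecated "refuted as stated (its t = 0 case speaks about the unconstrained slice u 0): see \
  Literature.Analysis.FluidPDE.not_cheskidov_luo_energy_equality and not_cheskidov_luo_energy_equality_of_pos \
  (DuchonRobertCheskidovLuoCounterexample.lean); corrected form = conclusion on Ioc 0 T (not vendored: no printed \
  forced-NSE source); for the L⁴ class use the theorem Literature.Analysis.FluidPDE.lions_energy_equality_Ioc'"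
  (since := "2026-08-16")]
def cheskidov_luo_energy_equality : Prop :=
  ∀ (hLH : Torus.IsLerayHopfOn T ν f u₀ u) (hν : 0 ≤ ν) (hu : FunctionSpaces.MemLpBesovSupVanishing 3 (1 / 3) 3 u volume (Ioo 0 T)) (hf : Torus.MemLqLp 1 2 f (Ioo 0 T)),
    ∀ t ∈ Icc 0 T,
      FunctionSpaces.Torus.kineticEnergy (u t) + ν * (∫⁻ τ in Ioo 0 t, FunctionSpaces.Torus.eGradNormSq (u τ)).toReal =
        FunctionSpaces.Torus.kineticEnergy u₀ + ∫ τ in 0..t, ∫ x, ⟪f τ x, u τ x⟫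

/-- **Unsupported as stated — deprecated (verdict clean-up 2026-08-16, found at the resolution of its
migration citation tag; review of p87875); kept, statement byte-for-byte.** The record was meant
to vendor **turb.S23, anomalous dissipation / anomalous work for the forced Navier–Stokes
equations** after Cheskidov–Luo, SIAM J. Math. Anal. 53 (2021) = arXiv:1910.04204, Thms. 1.2–1.4,
rendered as: there exist `ν > 0`, `T > 0`, a force `f ∈ L¹(0,T; L²(T³))`
(`Torus.MemLqLp 1 2 f (Ioo 0 T)`), a datum `u₀` and a Leray–Hopf solution `u`
(`Torus.IsLerayHopfOn T ν f u₀ u`) whose energy inequality is **strict** at time `T`,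
`½‖u(T)‖² + ν ∫₀ᵀ ‖∇u‖₂² < ½‖u₀‖² + ∫₀ᵀ∫ ⟪f, u⟫` (spectral dissipation `Torus.eGradNormSq`).
**What is printed** (Thm. 1.4, §1.3, p. 5 of the arXiv text): "For any `ε > 0` and dimension
`d ≥ 3`, there exists a solution `(u,f) ∈ 𝒩(Q_T)` such that `(u,f)` satisfies the energy equality
on `[0,T)` …, the anomalous work vanishes …, and the energy is jump discontinuous at `t = T`,
`lim_{t→T⁻} ‖u(t)‖₂² > ‖u(T)‖₂²`. Moreover, `u` is almost Onsager critical: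
`u ∈ L³_t B^{1/3-ε}_{3,∞} ∩ L^p_t L^q_x` for any `2/p + 2/q = 1 + ε` and `f` is almost Leray-Hopf:
`f ∈ L^{2-ε}_t H^{-1}`", where `𝒩(Q_T)` (Def. 2.1, p. 8) is the class of pairs `(u, f)` smooth on
`T^d × (0,T)` with `u ∈ L^∞(0,T; L²)`, finite energy input `⟨u, f⟩ ∈ 𝓛(0,T)` and `f(t)` having
limits in `𝒟'` as `t → 0⁺`, `t → T⁻` (the equations carry `ν = 1`), and (§2.2, p. 9) "in general
`(u,f) ∈ 𝒩(Q_T)` is not a Leray-Hopf weak solution on `[0,T]`" (Thms. 1.2 and 1.6 are the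
companion positive result for `f ∈ L^p(0,T; H^{-2+2/p})`, `1 ≤ p ≤ 2`, and the continuous-energy
example). **What is wrong:** the record asserts the force class `f ∈ L¹(0,T; L²)` and the tree's
Leray–Hopf packaging `Torus.IsLerayHopfOn T ν f u₀ u` on `T³`, neither of which is printed — the
printed force is only `L^{2-ε}_t H^{-1}` (smooth inside `(0,T)`), and the printed packaging is
`𝒩(Q_T)` — so it is an existence claim strictly stronger than / different from the source, which
no citation tag can certify; it is not refuted either. **Use instead:** nothing in tree yet — a
faithful vendoring must state Thm. 1.4 in its printed class (`𝒩(Q_T)`-style packaging,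
`f ∈ L^{2-ε}_t H^{-1}`, energy equality on `[0,T)`, jump at `T`), which needs vocabulary
(`H^{-1}`-valued time-Lebesgue classes of the force, the class `𝓛(0,T)`) this file does not have;
left to a planner / literature seat. No `cheskidov_luo_anomalous_holds` should be attempted
against this rendering.
[cite: CheskidovLuo2021, Thm. 1.4 (printed form quoted above; the record's L¹_t L²_x force and IsLerayHopfOn packaging are NOT printed)] -/
@[deprecated "unsupported as stated (the force class f ∈ L¹_t L²_x and the Torus.IsLerayHopfOn packaging are not printed): \
  Cheskidov–Luo 2021, Thm. 1.4 gives (u,f) ∈ 𝒩(Q_T) smooth on (0,T), f ∈ L^{2-ε}_t H^{-1}, the energy equality on [0,T) \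
  and an energy jump at t = T; no faithful restatement in tree yet (needs H^{-1}-force vocabulary)" (since := "2026-08-16")]
def cheskidov_luo_anomalous : Prop :=
  ∃ ν : ℝ, 0 < ν ∧ ∃ T : ℝ, 0 < T ∧
      ∃ (f : ℝ → UnitAddTorus (Fin 3) → EuclideanSpace ℝ (Fin 3))
        (u₀ : UnitAddTorus (Fin 3) → EuclideanSpace ℝ (Fin 3))
        (u : ℝ → UnitAddTorus (Fin 3) → EuclideanSpace ℝ (Fin 3)),
        Torus.MemLqLp 1 2 f (Ioo 0 T) ∧ Torus.IsLerayHopfOn T ν f u₀ u ∧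
          FunctionSpaces.Torus.kineticEnergy (u T) + ν * (∫⁻ τ in Ioo 0 T, FunctionSpaces.Torus.eGradNormSq (u τ)).toReal <
            FunctionSpaces.Torus.kineticEnergy u₀ + ∫ τ in 0..T, ∫ x, ⟪f τ x, u τ x⟫

end EnergyEquality

end Literature.Analysis.FluidPDE
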